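import Summits.BirchSwinnertonDyer.BirchSwinnertonDyer.Theorems.ManinLocalTwoThreeVertexTail
import Summits.BirchSwinnertonDyer.BirchSwinnertonDyer.Theorems.ManinLocalTwoThreeAtkinLehnerStep
import Summits.BirchSwinnertonDyer.BirchSwinnertonDyer.Theorems.ManinLocalTwoThreeParabolicCuspFunction
import HarnessLib

/-!
# The vertex step ASSEMBLED: `t`-old up to a diamond (E-es-41m) + Atkin–Lehner (E-es-42) + amalgam (E-es-43) ⟹ vanishing

Summit `BirchSwinnertonDyer`, route `ManinLocalTwoThree` (cell bsd-f2-manin), crux C2 `ManinOddAtFour` (stmt-BirchSwinnertonDyer-22967),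
line `kato_shift_two` v6, stub 3 `stub_cThreeImageResidual` (the 3 950 `C₃`-image classes); MEMO-es §25.10 «the vertex step, final
chain» (V-a) … (V-e) and §25.12 ASSEMBLY ORDER (6)–(11).  This is the lead's 04:27:26Z assignment to seat p3: the E-es-41m VERTEX
ASSEMBLY over {E-es-43 (FACT, -ty), the extension ũ₀ (E-es-41m: EXT-ODD/EXT-TWO, p2), E-es-42 (p1, `atkinLehnerStep_of_sigma2`),
E-es-34 (p599410), END (p599806)} — written so that the three inputs enter as HYPOTHESES in exactly the currency of
HOME/es/Sketch-es-g12.lean (`ShiftInvariantIsOldUpToDiamondMin`, `AtkinLehnerStep`, `DeltaCharacterExtension`, all unfolded), and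
everything downstream of them is PROVED here:

* §1 `exists_Gamma0_dvd_apply_zero_zero` — an `h₀ ∈ Γ₀(L′)` with `t ∣ a_{h₀}` (`t`, `L′` coprime): the Atkin–Lehner element is
  `W = diag(1,t) h₀`, and `A_t = t · h₀ · W⁻¹`.
* §2 the decomposition `u₁ = π₁^* u₀ + ψ∘(d mod t)` forces `ψ` additive on the `d`-entries and `ψ 1 = 0`.
* §3 **(V-c) `shiftInvariant_base_of_atkinLehner`** — if `u₁ = π₁^* u₀ + ψ∘d` on `Γ₀(L′t)` and `u₁` is `Ad(W)`-invariant
  (E-es-42's conclusion), then `u₀` is `t`-SHIFT-INVARIANT on `Γ₀(L′t)`: `u₀(A γ A⁻¹) = u₀(h₀ β′ h₀⁻¹) = u₀(β′) = u₁(β′) − ψ(d_{β′})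
  = u₁(γ) − ψ(d_γ)`, the last step because `d_γ d_{β′} ≡ 1 (mod t)` and `ψ(x⁻¹) = −ψ(x) = ψ(x)` in characteristic `2`.
* §4 **`eq_zero_of_vertexInputs`** — (V-d)/(V-e): E-es-43 gives `Φ` on `Δ_t(L′)` with `Φ∘ι = u₀`; parabolicity of `u₁` kills
  `Φ` on `U⁺(ℤ)`, `U⁻(L′tℤ)` (`deltaHom_integral_unipotents_of_parabolic`), so `Φ∘ι` is a diamond character mod `L′` on `Γ₀(L′t)`
  (`exists_diamond_of_deltaHom_of_integral_mul`, E-es-34), hence `u₁ = η(d mod L′) + ψ(d mod t)` is a diamond function of level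
  `L′t`, and ONE prime `r ∉ S` with `λ_r ≠ r + 1` kills it (`eq_zero_of_coe_eq_diamondFun_of_ne`, END).
  `eq_zero_of_deltaCharacterExtension_of_not_dvd` — the case `k = v_t(L) = 0` (§25.11 (b)): E-es-43 alone suffices.
  (Sequel `Theorems/ManinLocalTwoThreeVertexLeaf.lean`: the body of es's E-es-36x at `p = 2` from the three input bodies.)

No new definitions; nothing about BSD or Manin's conjecture is proved here.  Characteristic `2` is used exactly once (§3, `ψ(x⁻¹) = ψ(x)`).

References: G. Shimura (1971) §8.3 [cite: Shimura1971, §8.3 (8.3.2)]; J.-P. Serre, *Trees* II.1.4; A. O. L. Atkin, J. Lehner, Math. Ann.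
185 (1970) Lemma 11; cell memo HOME/MEMO-es.md §25.10–§25.12; HOME/es/Sketch-es-g12.lean (E-es-36x/41m/42/43 texts).
-/

set_option autoImplicit false
set_option linter.dupNamespace false

open scoped MatrixGroups

open CongruenceSubgroup Literature.NumberTheory.EllipticCurves.ModularForms
  Literature.NumberTheory.EllipticCurves.ModularForms.HidaCohomology
  Summit.BirchSwinnertonDyer.BirchSwinnertonDyer.Theorems.ConjSpanGenAllLevels
  Summit.BirchSwinnertonDyer.Rank1Residual.ManinAdditive

namespace Summit.BirchSwinnertonDyer.BirchSwinnertonDyer.Theorems.ManinLocalTwoThree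

noncomputable section

/-! ### §1  Plumbing: an element of `Γ₀(L′)` with `t ∣ a`, conjugation entries, additivity of degree-`0` cocycles -/

section Plumbing

/-- For `t`, `L′` coprime there is `h₀ = (t, −y; L′, w) ∈ Γ₀(L′)` with `t ∣ a_{h₀}` (Bezout). [folklore] -/
theorem exists_Gamma0_dvd_apply_zero_zero {t L' : ℕ} (hcop : Nat.Coprime t L') :
    ∃ h : Gamma0 L', (t : ℤ) ∣ (h : SL(2, ℤ)) 0 0 := by
  obtain ⟨w, y, hwy⟩ : ∃ w y : ℤ, (t : ℤ) * w + (L' : ℤ) * y = 1 := by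
    refine ⟨Int.gcdA t L', Int.gcdB t L', ?_⟩
    rw [← Int.gcd_eq_gcd_ab, Int.gcd_natCast_natCast, hcop]; rfl
  let g : SL(2, ℤ) := ⟨!![(t : ℤ), -y; (L' : ℤ), w], by rw [Matrix.det_fin_two_of]; linear_combination hwy⟩
  refine ⟨⟨g, ?_⟩, ?_⟩
  · rw [Gamma0_mem]
    show (((L' : ℤ)) : ZMod L') = 0
    simp
  · exact dvd_rfl

/-- Entry `(1,1)` of `h β h⁻¹` (plumbing). [folklore] -/
theorem conj_apply_one_one (h β : SL(2, ℤ)) :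
    (h * β * h⁻¹) 1 1 = h 0 0 * h 1 1 * β 1 1 - h 0 1 * h 1 0 * β 0 0 + h 0 0 * h 1 0 * β 0 1 - h 0 1 * h 1 1 * β 1 0 := by
  simp [Matrix.SpecialLinearGroup.coe_mul, Matrix.SpecialLinearGroup.coe_inv, Matrix.adjugate_fin_two, Matrix.mul_apply,
    Fin.sum_univ_two]
  ring

/-- Entries of the inverse in `SL₂(ℤ)` (plumbing). [folklore] -/
theorem inv_apply_one_zero (h : SL(2, ℤ)) : (h⁻¹) 1 0 = -h 1 0 := by
  rw [Matrix.SpecialLinearGroup.SL2_inv_expl]; rfl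

/-- Entries of the inverse in `SL₂(ℤ)` (plumbing). [folklore] -/
theorem inv_apply_one_one (h : SL(2, ℤ)) : (h⁻¹) 1 1 = h 0 0 := by
  rw [Matrix.SpecialLinearGroup.SL2_inv_expl]; rfl

/-- Entry `(1,0)` of `h⁻¹ Y h` (plumbing, from p1's `conj_apply_one_zero`). [folklore] -/
theorem inv_conj_apply_one_zero (h Y : SL(2, ℤ)) :
    (h⁻¹ * Y * h) 1 0 = h 0 0 * h 1 0 * (Y 1 1 - Y 0 0) + h 0 0 ^ 2 * Y 1 0 - h 1 0 ^ 2 * Y 0 1 := by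
  have e : h⁻¹ * Y * h = h⁻¹ * Y * h⁻¹⁻¹ := by rw [inv_inv]
  rw [e, conj_apply_one_zero, inv_apply_one_zero, inv_apply_one_one]
  ring

/-- `a d ≡ 1 (mod m)` for `γ ∈ Γ₀(N)`, `m ∣ N`. [folklore] -/
theorem gamma0_a_mul_d_cast {N m : ℕ} (hm : m ∣ N) (γ : Gamma0 N) :
    ((((γ : SL(2, ℤ)) 0 0 : ℤ) : ZMod m)) * ((((γ : SL(2, ℤ)) 1 1 : ℤ) : ZMod m)) = 1 := by
  have hdet := Matrix.SpecialLinearGroup.det_coe (γ : SL(2, ℤ))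
  rw [Matrix.det_fin_two] at hdet
  have hc := gamma0_c_cast_eq_zero hm γ
  have := congrArg (fun z : ℤ => (z : ZMod m)) hdet
  simp only [Int.cast_sub, Int.cast_mul, Int.cast_one] at this
  rw [hc, mul_zero, sub_zero] at this
  exact this

end Plumbing

/-! ### §2  The decomposition `u₁ = π₁^* u₀ + ψ∘(d mod t)` -/

section Dec

variable {t L' : ℕ} {K : Type*} [Field K]
  (u : cocycles 0 (L' * t) K) (u₀ : cocycles 0 L' K) (ψ : ZMod t → K)
  (hdec : (u : Gamma0 (L' * t) → Fin 1 → K) =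
    degeneracyPullback 0 L' (L' * t) 1 K (by simp) (u₀ : Gamma0 L' → Fin 1 → K) + diamondFun (L' * t) t K ψ)

include hdec

/-- Pointwise form of the decomposition. [folklore] -/
theorem dec_apply (γ : Gamma0 (L' * t)) :
    (u : Gamma0 (L' * t) → Fin 1 → K) γ 0 =
      (u₀ : Gamma0 L' → Fin 1 → K) (Gamma0.degeneracyConj L' (L' * t) 1 (by simp) γ) 0 +
        ψ ((((γ : SL(2, ℤ)) 1 1 : ℤ) : ZMod t)) := by
  have := congrFun (congrFun hdec γ) 0
  rw [this, Pi.add_apply, Pi.add_apply, degeneracyPullback_zero_apply, diamondFun_apply]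

/-- The diamond part `ψ∘d = u₁ − π₁^* u₀` is a cocycle, so `ψ` is additive along products in `Γ₀(L′t)`. [folklore] -/
theorem psi_mul (γ δ : Gamma0 (L' * t)) :
    ψ ((((γ * δ : Gamma0 (L' * t)) : SL(2, ℤ)) 1 1 : ℤ) : ZMod t) =
      ψ ((((γ : SL(2, ℤ)) 1 1 : ℤ) : ZMod t)) + ψ ((((δ : SL(2, ℤ)) 1 1 : ℤ) : ZMod t)) := by
  have hD : diamondFun (L' * t) t K ψ ∈ cocycles 0 (L' * t) K := by
    have e : diamondFun (L' * t) t K ψ =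
        (u : Gamma0 (L' * t) → Fin 1 → K) - degeneracyPullback 0 L' (L' * t) 1 K (by simp) (u₀ : Gamma0 L' → Fin 1 → K) := by
      rw [hdec]; abel
    rw [e]
    exact sub_mem u.2 (degeneracyPullback_mem_cocycles _ u₀.2)
  have := congrFun (cocycle_zero_mul hD γ δ) 0
  simpa only [diamondFun_apply, Pi.add_apply] using this

/-- `ψ 1 = 0`. [folklore] -/
theorem psi_one : ψ 1 = 0 := by
  have h := psi_mul u u₀ ψ hdec 1 1
  have e : ((((1 : Gamma0 (L' * t)) : SL(2, ℤ)) 1 1 : ℤ) : ZMod t) = 1 := by simp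
  rw [mul_one, e] at h
  simpa using h

end Dec

/-! ### §3  (V-c): `Ad(W)`-invariance of `u₁` makes `u₀` shift-invariant -/

section Vc

variable {t L' : ℕ} {K : Type*} [Field K] [CharP K 2] [NeZero t]

/-- **(V-c) of MEMO-es §25.10.**  Let `u₁ = π₁^* u₀ + ψ∘(d mod t)` on `Γ₀(L′t)` (`u₀` a homomorphism on `Γ₀(L′)`, the
E-es-41m decomposition), let `h₀ ∈ Γ₀(L′)` with `t ∣ a_{h₀}` (`t`, `L′` coprime), and suppose `u₁` is invariant under the
Atkin–Lehner element `W = diag(1,t) h₀` in the entrywise currency of E-es-42 (`h₀ γ h₀⁻¹ = A_t β A_t⁻¹ ⟹ u₁ β = u₁ γ`).  Then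
`u₀` is `t`-shift-invariant on `Γ₀(L′t)`: for `γ ∈ Γ₀(L′t)`, `Y := A_t γ A_t⁻¹ ∈ Γ₀(L′)` and `β′ := h₀⁻¹ Y h₀ ∈ Γ₀(L′t)`, so
`u₀(Y) = u₀(β′) = u₁(β′) − ψ(d_{β′}) = u₁(γ) − ψ(d_γ)` — using `d_γ d_{β′} ≡ 1 (mod t)` and characteristic `2`.
[cite: Shimura1971, §8.3 (8.3.2)] -/
theorem shiftInvariant_base_of_atkinLehner (hcop : Nat.Coprime t L')
    (u : cocycles 0 (L' * t) K) (u₀ : cocycles 0 L' K) (ψ : ZMod t → K)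
    (hdec : (u : Gamma0 (L' * t) → Fin 1 → K) =
      degeneracyPullback 0 L' (L' * t) 1 K (by simp) (u₀ : Gamma0 L' → Fin 1 → K) + diamondFun (L' * t) t K ψ)
    (h42 : ∀ h : Gamma0 L', (t : ℤ) ∣ (h : SL(2, ℤ)) 0 0 → ∀ γ β : Gamma0 (L' * t),
      (((h : SL(2, ℤ)) * (γ : SL(2, ℤ)) * (h : SL(2, ℤ))⁻¹) 0 0 = (β : SL(2, ℤ)) 0 0 ∧
        ((h : SL(2, ℤ)) * (γ : SL(2, ℤ)) * (h : SL(2, ℤ))⁻¹) 0 1 = (t : ℤ) * (β : SL(2, ℤ)) 0 1 ∧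
        (t : ℤ) * ((h : SL(2, ℤ)) * (γ : SL(2, ℤ)) * (h : SL(2, ℤ))⁻¹) 1 0 = (β : SL(2, ℤ)) 1 0 ∧
        ((h : SL(2, ℤ)) * (γ : SL(2, ℤ)) * (h : SL(2, ℤ))⁻¹) 1 1 = (β : SL(2, ℤ)) 1 1) →
      (u : Gamma0 (L' * t) → Fin 1 → K) β = (u : Gamma0 (L' * t) → Fin 1 → K) γ)
    (h₀ : Gamma0 L') (hh₀ : (t : ℤ) ∣ (h₀ : SL(2, ℤ)) 0 0) :
    degeneracyPullback 0 L' (L' * t) t K dvd_rfl (u₀ : Gamma0 L' → Fin 1 → K) =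
      degeneracyPullback 0 L' (L' * t) 1 K (by simp) (u₀ : Gamma0 L' → Fin 1 → K) := by
  funext γ i
  obtain rfl : i = 0 := Fin.eq_zero i
  rw [degeneracyPullback_zero_apply, degeneracyPullback_zero_apply]
  set Y : Gamma0 L' := Gamma0.degeneracyConj L' (L' * t) t dvd_rfl γ with hYdef
  have hY00 : ((Y : SL(2, ℤ)) 0 0) = (γ : SL(2, ℤ)) 0 0 := Gamma0.degeneracyConjElt_apply_zero_zero dvd_rfl γ
  have hY01 : ((Y : SL(2, ℤ)) 0 1) = (t : ℤ) * (γ : SL(2, ℤ)) 0 1 := Gamma0.degeneracyConjElt_apply_zero_one dvd_rfl γ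
  have hY10 : ((Y : SL(2, ℤ)) 1 0) = (γ : SL(2, ℤ)) 1 0 / t := Gamma0.degeneracyConjElt_apply_one_zero dvd_rfl γ
  have hY11 : ((Y : SL(2, ℤ)) 1 1) = (γ : SL(2, ℤ)) 1 1 := Gamma0.degeneracyConjElt_apply_one_one dvd_rfl γ
  have htL : (t : ℤ) ∣ ((L' * t : ℕ) : ℤ) := ⟨(L' : ℤ), by push_cast; ring⟩
  have hLL : (L' : ℤ) ∣ ((L' * t : ℕ) : ℤ) := ⟨(t : ℤ), by push_cast; ring⟩
  have htc : (t : ℤ) ∣ (γ : SL(2, ℤ)) 1 0 := htL.trans (ManinFrameResidueProperRTameTwist.natCast_dvd_entry10 γ)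
  have hY10' : (t : ℤ) * (Y : SL(2, ℤ)) 1 0 = (γ : SL(2, ℤ)) 1 0 := by rw [hY10]; exact Int.mul_ediv_cancel' htc
  -- `β′ := h₀⁻¹ Y h₀ ∈ Γ₀(L′ t)`
  set β'₀ : Gamma0 L' := h₀⁻¹ * Y * h₀ with hβ'₀
  have hcoeβ : ((β'₀ : SL(2, ℤ))) = (h₀ : SL(2, ℤ))⁻¹ * (Y : SL(2, ℤ)) * (h₀ : SL(2, ℤ)) := by
    rw [hβ'₀]; push_cast; rfl
  have hβ't : (t : ℤ) ∣ (β'₀ : SL(2, ℤ)) 1 0 := by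
    rw [hcoeβ, inv_conj_apply_one_zero, hY01]
    exact (((hh₀.mul_right _).mul_right _).add ((hh₀.pow two_ne_zero).mul_right _)).sub
      (Dvd.dvd.mul_left (dvd_mul_right _ _) _)
  have hβ'L' : (L' : ℤ) ∣ (β'₀ : SL(2, ℤ)) 1 0 := ManinFrameResidueProperRTameTwist.natCast_dvd_entry10 β'₀
  have hβ'L : ((L' * t : ℕ) : ℤ) ∣ (β'₀ : SL(2, ℤ)) 1 0 := by
    push_cast
    exact Int.isCoprime_iff_gcd_eq_one.mpr (by rw [Int.gcd_natCast_natCast]; exact hcop.symm) |>.mul_dvd hβ'L' hβ't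
  let β' : Gamma0 (L' * t) := ⟨(β'₀ : SL(2, ℤ)), by
    rw [Gamma0_mem]; exact (ZMod.intCast_zmod_eq_zero_iff_dvd _ _).2 hβ'L⟩
  have hcoeβ' : ((β' : SL(2, ℤ))) = (β'₀ : SL(2, ℤ)) := rfl
  -- `h₀ β′ h₀⁻¹ = Y = A γ A⁻¹` entrywise: E-es-42 applies to the pair `(β′, γ)`
  have hconj : (h₀ : SL(2, ℤ)) * (β' : SL(2, ℤ)) * (h₀ : SL(2, ℤ))⁻¹ = (Y : SL(2, ℤ)) := by
    rw [hcoeβ', hcoeβ]; group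
  have huγ : (u : Gamma0 (L' * t) → Fin 1 → K) γ = (u : Gamma0 (L' * t) → Fin 1 → K) β' :=
    h42 h₀ hh₀ β' γ (by rw [hconj]; exact ⟨hY00, hY01, hY10', hY11⟩)
  -- `d_γ · d_{β′} ≡ 1 (mod t)`
  have hx : ((((h₀ : SL(2, ℤ)) 0 0 : ℤ)) : ZMod t) = 0 := (ZMod.intCast_zmod_eq_zero_iff_dvd _ _).2 hh₀
  have hc' : ((((β'₀ : SL(2, ℤ)) 1 0 : ℤ)) : ZMod t) = 0 := (ZMod.intCast_zmod_eq_zero_iff_dvd _ _).2 hβ't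
  have hdeth : ((h₀ : SL(2, ℤ)) 0 0 : ℤ) * (h₀ : SL(2, ℤ)) 1 1 - (h₀ : SL(2, ℤ)) 0 1 * (h₀ : SL(2, ℤ)) 1 0 = 1 := by
    have := Matrix.SpecialLinearGroup.det_coe (h₀ : SL(2, ℤ)); rwa [Matrix.det_fin_two] at this
  have hdetβ : ((β'₀ : SL(2, ℤ)) 0 0 : ℤ) * (β'₀ : SL(2, ℤ)) 1 1 - (β'₀ : SL(2, ℤ)) 0 1 * (β'₀ : SL(2, ℤ)) 1 0 = 1 := by
    have := Matrix.SpecialLinearGroup.det_coe (β'₀ : SL(2, ℤ)); rwa [Matrix.det_fin_two] at this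
  have hYβ : (Y : SL(2, ℤ)) = (h₀ : SL(2, ℤ)) * (β'₀ : SL(2, ℤ)) * (h₀ : SL(2, ℤ))⁻¹ := by rw [hcoeβ]; group
  have hkey : ((((γ : SL(2, ℤ)) 1 1 : ℤ)) : ZMod t) * ((((β'₀ : SL(2, ℤ)) 1 1 : ℤ)) : ZMod t) = 1 := by
    rw [← hY11, hYβ, conj_apply_one_one]
    have e1 := congrArg (fun z : ℤ => (z : ZMod t)) hdeth
    have e2 := congrArg (fun z : ℤ => (z : ZMod t)) hdetβ
    simp only [Int.cast_sub, Int.cast_mul, Int.cast_one] at e1 e2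
    push_cast
    rw [hx, hc'] at *
    linear_combination ((((β'₀ : SL(2, ℤ)) 0 0 : ℤ) : ZMod t) * (((β'₀ : SL(2, ℤ)) 1 1 : ℤ) : ZMod t)) * e1 + e2
  -- hence `ψ(d_γ) = ψ(d_{β′})` (characteristic 2)
  have hψ : ψ ((((γ : SL(2, ℤ)) 1 1 : ℤ) : ZMod t)) = ψ ((((β' : SL(2, ℤ)) 1 1 : ℤ) : ZMod t)) := by
    have hadd := psi_mul u u₀ ψ hdec γ β'
    rw [gamma0_d_mul_cast (Dvd.intro_left _ rfl) γ β', hcoeβ', hkey, psi_one u u₀ ψ hdec] at hadd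
    rw [hcoeβ']
    have : ψ ((((γ : SL(2, ℤ)) 1 1 : ℤ) : ZMod t)) = -ψ ((((β'₀ : SL(2, ℤ)) 1 1 : ℤ) : ZMod t)) := by
      linear_combination hadd.symm
    rw [this, CharTwo.neg_eq]
  -- assemble
  have e1 := dec_apply u u₀ ψ hdec γ
  have e2 := dec_apply u u₀ ψ hdec β'
  have c2 : Gamma0.degeneracyConj L' (L' * t) 1 (by simp) β' = β'₀ :=
    Subtype.ext (Gamma0.coe_degeneracyConj_one _ β')
  rw [c2] at e2
  have hYu : (u₀ : Gamma0 L' → Fin 1 → K) Y = (u₀ : Gamma0 L' → Fin 1 → K) β'₀ := by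
    have : Y = h₀ * β'₀ * h₀⁻¹ := by rw [hβ'₀]; group
    rw [this, cocycle_zero_conj u₀.2 h₀ β'₀]
  rw [hYu]
  have := congrFun huγ 0
  rw [e1, e2, hψ] at this
  exact (add_right_cancel this).symm

end Vc

/-! ### §4  (V-d)/(V-e): the assembled vertex vanishing -/

section Vertex

variable {t L' : ℕ} {K : Type*} [Field K] [CharP K 2] [NeZero L'] [NeZero t]

/-- **The vertex step, assembled (MEMO-es §25.10 (V-a)…(V-e), §25.12 (6)–(10)).**  Let `t` be a prime not dividing `L′`,
`u₁` a homomorphism on `Γ₀(L′t)` (a degree-`0` cocycle over a field of characteristic `2`) which is PARABOLIC (kills every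
cusp-fixing element) and a generalised Hecke eigenvector off `S ⊇ primes(L′t)` for a system `λ` with ONE prime `r ∉ S`,
`λ_r ≠ r + 1`.  Assume the three inputs of the vertex chain FOR THIS `u₁`: (E-es-41m) `u₁ = π₁^* u₀ + ψ∘(d mod t)` for a
homomorphism `u₀` on `Γ₀(L′)`; (E-es-42) `u₁` is `Ad(W)`-invariant for the Atkin–Lehner elements `W = diag(1,t) h`, `h ∈ Γ₀(L′)`,
`t ∣ a_h`; (E-es-43) every `t`-shift-invariant homomorphism on `Γ₀(L′)` extends to a `Δ_t(L′)`-additive function on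
`SL₂(ℤ[1/t])`.  Then `u₁ = 0`.  [(V-c) `shiftInvariant_base_of_atkinLehner`; (V-d) `deltaHom_integral_unipotents_of_parabolic` +
`exists_diamond_of_deltaHom_of_integral_mul` (E-es-34); (V-e) `eq_zero_of_coe_eq_diamondFun_of_ne` (END).]
[cite: Shimura1971, §8.3 (8.3.2)] -/
theorem eq_zero_of_vertexInputs (ht : t.Prime) (hL' : ¬ t ∣ L')
    (S : Finset ℕ) (lam : ℕ → K) (u : cocycles 0 (L' * t) K)
    (hS : ∀ q : ℕ, q.Prime → q ∣ L' * t → q ∈ S)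
    (hgen : IsHeckeGenEigenvector S lam u)
    (hNT : ∃ r : ℕ, r.Prime ∧ r ∉ S ∧ lam r ≠ (r : K) + 1)
    (hpar : ∀ γ : Gamma0 (L' * t), ∀ c : OnePoint ℚ,
      Matrix.SpecialLinearGroup.mapGL ℚ (γ : SL(2, ℤ)) • c = c → (u : Gamma0 (L' * t) → Fin 1 → K) γ 0 = 0)
    (h41 : ∃ (u₀ : cocycles 0 L' K) (ψ : ZMod t → K),
      (u : Gamma0 (L' * t) → Fin 1 → K) =
        degeneracyPullback 0 L' (L' * t) 1 K (by simp) (u₀ : Gamma0 L' → Fin 1 → K) + diamondFun (L' * t) t K ψ)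
    (h42 : ∀ h : Gamma0 L', (t : ℤ) ∣ (h : SL(2, ℤ)) 0 0 → ∀ γ β : Gamma0 (L' * t),
      (((h : SL(2, ℤ)) * (γ : SL(2, ℤ)) * (h : SL(2, ℤ))⁻¹) 0 0 = (β : SL(2, ℤ)) 0 0 ∧
        ((h : SL(2, ℤ)) * (γ : SL(2, ℤ)) * (h : SL(2, ℤ))⁻¹) 0 1 = (t : ℤ) * (β : SL(2, ℤ)) 0 1 ∧
        (t : ℤ) * ((h : SL(2, ℤ)) * (γ : SL(2, ℤ)) * (h : SL(2, ℤ))⁻¹) 1 0 = (β : SL(2, ℤ)) 1 0 ∧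
        ((h : SL(2, ℤ)) * (γ : SL(2, ℤ)) * (h : SL(2, ℤ))⁻¹) 1 1 = (β : SL(2, ℤ)) 1 1) →
      (u : Gamma0 (L' * t) → Fin 1 → K) β = (u : Gamma0 (L' * t) → Fin 1 → K) γ)
    (h43 : ∀ u₀ : cocycles 0 L' K,
      degeneracyPullback 0 L' (L' * t) t K dvd_rfl (u₀ : Gamma0 L' → Fin 1 → K) =
        degeneracyPullback 0 L' (L' * t) 1 K (by simp) (u₀ : Gamma0 L' → Fin 1 → K) →
      ∃ Φ : SL(2, Away t) → K,
        (∀ g ∈ Delta t L', ∀ g' ∈ Delta t L', Φ (g * g') = Φ g + Φ g') ∧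
        ∀ γ : Gamma0 L', Φ (iota t (γ : SL(2, ℤ))) = (u₀ : Gamma0 L' → Fin 1 → K) γ 0) :
    u = 0 := by
  obtain ⟨u₀, ψ, hdec⟩ := h41
  have hcop : Nat.Coprime t L' := (Nat.Prime.coprime_iff_not_dvd ht).2 hL'
  obtain ⟨h₀, hh₀⟩ := exists_Gamma0_dvd_apply_zero_zero hcop
  have hshift₀ := shiftInvariant_base_of_atkinLehner hcop u u₀ ψ hdec h42 h₀ hh₀
  obtain ⟨Φ, hΦadd, hΦι⟩ := h43 u₀ hshift₀
  -- `Φ ∘ ι = u₁` on the elements of `Γ₀(L′t)` with `a = d = 1`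
  have hφu : ∀ γ : Gamma0 (L' * t), ((γ : SL(2, ℤ)) 0 0 : ℤ) = 1 → ((γ : SL(2, ℤ)) 1 1 : ℤ) = 1 →
      Φ (iota t (γ : SL(2, ℤ))) = (u : Gamma0 (L' * t) → Fin 1 → K) γ 0 := by
    intro γ _ h11
    have e := dec_apply u u₀ ψ hdec γ
    rw [h11, Int.cast_one, psi_one u u₀ ψ hdec, add_zero] at e
    rw [e, ← hΦι (Gamma0.degeneracyConj L' (L' * t) 1 (by simp) γ), Gamma0.coe_degeneracyConj_one]
  obtain ⟨hU, hL⟩ := deltaHom_integral_unipotents_of_parabolic Φ (u : Gamma0 (L' * t) → Fin 1 → K) hφu hpar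
  obtain ⟨η, hη, hηι⟩ :=
    exists_diamond_of_deltaHom_of_integral_mul (M := L' * t) ht.two_le (Dvd.intro _ rfl) Φ hΦadd hU hL
  -- `u₁ = η(d mod L′) + ψ(d mod t)`, a diamond function of level `L′t`
  have hL'd : L' ∣ L' * t := Dvd.intro _ rfl
  have htd : t ∣ L' * t := Dvd.intro_left _ rfl
  let θ : ZMod (L' * t) → K := fun x => η (ZMod.castHom hL'd (ZMod L') x) + ψ (ZMod.castHom htd (ZMod t) x)
  have hdiam : (u : Gamma0 (L' * t) → Fin 1 → K) = diamondFun (L' * t) (L' * t) K θ := by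
    funext γ i
    obtain rfl : i = 0 := Fin.eq_zero i
    rw [diamondFun_apply, dec_apply u u₀ ψ hdec γ, ← hΦι (Gamma0.degeneracyConj L' (L' * t) 1 (by simp) γ),
      Gamma0.coe_degeneracyConj_one, hηι γ]
    simp only [θ, map_intCast]
  have hθ : ∀ a b : ZMod (L' * t), IsUnit a → IsUnit b → θ (a * b) = θ a + θ b := by
    intro a b ha hb
    obtain ⟨γa, hγa, hγa'⟩ := exists_mem_Gamma0_apply_one_one_eq ha
    obtain ⟨γb, hγb, hγb'⟩ := exists_mem_Gamma0_apply_one_one_eq hb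
    have hψab : ψ (ZMod.castHom htd (ZMod t) (a * b)) =
        ψ (ZMod.castHom htd (ZMod t) a) + ψ (ZMod.castHom htd (ZMod t) b) := by
      rw [← hγa', ← hγb', ← Int.cast_mul, map_intCast, map_intCast, map_intCast, Int.cast_mul]
      have := psi_mul u u₀ ψ hdec ⟨γa, hγa⟩ ⟨γb, hγb⟩
      rw [gamma0_d_mul_cast htd] at this
      exact this
    simp only [θ, map_mul]
    rw [hη _ _ (ha.map _) (hb.map _), ← map_mul, hψab]
    abel
  -- END with one prime `r ∉ S`, `λ_r ≠ r + 1`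
  obtain ⟨r, hr, hrS, hne⟩ := hNT
  haveI : NeZero r := ⟨hr.ne_zero⟩
  have hrM : ¬ r ∣ L' * t := fun h => hrS (hS r hr h)
  exact eq_zero_of_coe_eq_diamondFun_of_ne dvd_rfl u θ hθ hdiam hr hrM (hgen r hr hrS) hne

omit [CharP K 2] in
/-- **The case `k = v_t(L) = 0` (MEMO-es §25.11 (b), §25.12 (11)).**  For a prime `t ∤ L`, a `t`-shift-invariant parabolic
homomorphism `u` on `Γ₀(L)` which is generalised `λ`-eigen off `S ⊇ primes(L)` with ONE `r ∉ S`, `λ_r ≠ r + 1`, vanishes —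
from E-es-43 at `L′ := L` alone: `Φ∘ι = u`, the cusp values of `u` itself kill `Φ` on `U⁺(ℤ)`, `U⁻(Ltℤ)`, so `u` is a diamond
function mod `L` (E-es-34) and END applies.  [cite: Shimura1971, §8.3 (8.3.2)] -/
theorem eq_zero_of_deltaCharacterExtension_of_not_dvd {L : ℕ} [NeZero L] (ht : t.Prime)
    (S : Finset ℕ) (lam : ℕ → K) (u : cocycles 0 L K)
    (hS : ∀ q : ℕ, q.Prime → q ∣ L → q ∈ S)
    (hgen : IsHeckeGenEigenvector S lam u)
    (hNT : ∃ r : ℕ, r.Prime ∧ r ∉ S ∧ lam r ≠ (r : K) + 1)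
    (hpar : ∀ γ : Gamma0 L, ∀ c : OnePoint ℚ,
      Matrix.SpecialLinearGroup.mapGL ℚ (γ : SL(2, ℤ)) • c = c → (u : Gamma0 L → Fin 1 → K) γ 0 = 0)
    (hshift : degeneracyPullback 0 L (L * t) t K dvd_rfl (u : Gamma0 L → Fin 1 → K) =
      degeneracyPullback 0 L (L * t) 1 K (by simp) (u : Gamma0 L → Fin 1 → K))
    (h43 : ∀ u₀ : cocycles 0 L K,
      degeneracyPullback 0 L (L * t) t K dvd_rfl (u₀ : Gamma0 L → Fin 1 → K) =
        degeneracyPullback 0 L (L * t) 1 K (by simp) (u₀ : Gamma0 L → Fin 1 → K) →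
      ∃ Φ : SL(2, Away t) → K,
        (∀ g ∈ Delta t L, ∀ g' ∈ Delta t L, Φ (g * g') = Φ g + Φ g') ∧
        ∀ γ : Gamma0 L, Φ (iota t (γ : SL(2, ℤ))) = (u : Gamma0 L → Fin 1 → K) γ 0) :
    u = 0 := by
  obtain ⟨Φ, hΦadd, hΦι⟩ := h43 u hshift
  -- restriction of `u` to `Γ₀(L t)` is parabolic and agrees with `Φ ∘ ι`
  let u' : Gamma0 (L * t) → Fin 1 → K := degeneracyPullback 0 L (L * t) 1 K (by simp) (u : Gamma0 L → Fin 1 → K)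
  have hu' : ∀ γ : Gamma0 (L * t), u' γ = (u : Gamma0 L → Fin 1 → K) (Gamma0.degeneracyConj L (L * t) 1 (by simp) γ) :=
    fun γ => degeneracyPullback_zero_apply _ _ γ
  have hφu : ∀ γ : Gamma0 (L * t), ((γ : SL(2, ℤ)) 0 0 : ℤ) = 1 → ((γ : SL(2, ℤ)) 1 1 : ℤ) = 1 →
      Φ (iota t (γ : SL(2, ℤ))) = u' γ 0 := by
    intro γ _ _
    rw [hu', ← hΦι (Gamma0.degeneracyConj L (L * t) 1 (by simp) γ), Gamma0.coe_degeneracyConj_one]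
  have hpar' : ∀ γ : Gamma0 (L * t), ∀ c : OnePoint ℚ,
      Matrix.SpecialLinearGroup.mapGL ℚ (γ : SL(2, ℤ)) • c = c → u' γ 0 = 0 := by
    intro γ c hc
    rw [hu']
    refine hpar _ c ?_
    rw [Gamma0.coe_degeneracyConj_one]; exact hc
  obtain ⟨hU, hL⟩ := deltaHom_integral_unipotents_of_parabolic Φ u' hφu hpar'
  obtain ⟨η, hη, hηι⟩ := exists_diamond_of_deltaHom_of_integral_mul (M := L) ht.two_le dvd_rfl Φ hΦadd hU hL
  have hdiam : (u : Gamma0 L → Fin 1 → K) = diamondFun L L K η := by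
    funext γ i
    obtain rfl : i = 0 := Fin.eq_zero i
    rw [diamondFun_apply, ← hΦι γ, hηι γ]
  obtain ⟨r, hr, hrS, hne⟩ := hNT
  haveI : NeZero r := ⟨hr.ne_zero⟩
  have hrM : ¬ r ∣ L := fun h => hrS (hS r hr h)
  exact eq_zero_of_coe_eq_diamondFun_of_ne dvd_rfl u η hη hdiam hr hrM (hgen r hr hrS) hne

end Vertex

end

end Summit.BirchSwinnertonDyer.BirchSwinnertonDyer.Theorems.ManinLocalTwoThree
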